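/-
COR-CM (cells pub-hodgecm / pub-hodgecm2, stage 2 of the Hodge ladder) — TRANSPOSITION SURGE, item (vi) sub-binder S2, CM side.
Seat prover-pub-hodgecm2-pin-2-g2-0 = PINNING BUILDER 2 of 3 (hMatch / hCM), owner of record of `hCMisogE` and co-author (with
reader A) of the X2 residual list (HM-DELTA2-CLARITY §6).  Theorems only: no definition, no instance, no named fact, nothing
asserted, no proof holes.  FRAMING: HC_CM is NOT proved; hM is NOT signed equal; this file is NOT «Δ2 BRIDGE CLOSED».
-/
import Literature.NumberTheory.ComplexMultiplication.ReflexCMTypeOrientation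
import Summits.HodgeConjecture.CorCM.B01.Transposition.Item2Holds
import HarnessLib

/-!
# Item (vi) S2, CM side — X2 residual R2 (reflex-pair identification): the TREE-side transport kit

The X2 RECONCILIATION of record (hodge-director `HM-DELTA2-CLARITY.md` §6, qualified form: «X2a CLOSED-IN-TREE by
`Model.hCMisogE_of_det45`; named residual ADM-RECORD = R1 (✔ p310101) + R2 (port-literal) + R3 = X1») leaves, on the CM side,
exactly ONE identification to be written once the package modules `HodgeCM.Model.Binders.JLiuCornerOfReflex` (port layer L45)
and `HodgeCM.Model.LiuCMSideOfReflex` (L68) are in the tree: the package's admissibility predicate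
`LiuCMSide.IsReflexOfType ι₁ d Φ := d.IsReflexOf ι₁ (autSet ι₁ Φ)` asks for a ring isomorphism `ε : d.K' ≃+* ↥(reflexFieldOf T)`,
`T := autSet ι₁ Φ = {g | ι₁ ∘ g ∈ Φ}`, with
  (i)  `d.τ ∘ d.k = ι₁ ∘ incl ∘ ε`, and
  (ii) `∀ ψ, ψ ∈ d.Φ' ↔ ψ ∘ ε⁻¹ ∈ reflexTypeC ι₁ T`,
where (package `HodgeCMPerL/HodgeCM/Model/Binders/JLiuCornerOfReflex.lean`, RUN-82 bytes, verbatim bodies: `autImage` :72, `reflexFieldOf` :75,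
`reflexTypeC` :79–:82, `IsReflexOf` :85–:89, `autSet` :176, `IsReflexOfType` :188; the staged port copy `port/staging/L45/…` is the same
+1 PORT-header line) `autImage T := (fun σ ↦ (σ : L →ₐ[ℚ] L)) '' T`,
`reflexFieldOf T := reflexField ℚ L (autImage T)` and
`reflexTypeC ι₁ T := {ψ | ∃ g ∈ reflexLift (autImage T) (AlgHom.id ℚ L), ψ = (ι₁.comp ↑g).comp (algebraMap ↥(reflexFieldOf T) L)}`
— all three written over the TREE declarations `reflexField` / `reflexLift` (the package vendored them; the port re-aliases).
The tree's CM side (R1, `Item6PinMatchDef45Principal.lean`) presents the reflex pair as `K' := ↥(reflexField ℚ L (algValuedIn ι₁ Φ.1))`,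
`Φ' := (reflexCMType ι₁ Φ (AlgHom.id ℚ L)).1` ([Shimura1998 §8.3 Prop. 28], tree `ReflexCMType.lean`).

THIS FILE proves, in the tree kernel and in tree vocabulary only (no package token), the three sentences that make (i)–(ii) a
definitional unfolding after the port:
* `image_coe_setOf_comp_mem_eq_algValuedIn` — the package index set, WRITTEN AS ITS BODY, equals the tree's `algValuedIn ι₁ Φ.1`
  (x2 g6 probe 127f14c47e92 (F), here as a tree theorem);
* `mem_reflexCMType_id_iff_exists_mem_reflexLift` — the tree reflex type IS the package body at the tree index set:
  `τ ∈ Φ*_ℂ ↔ ∃ g ∈ reflexLift (algValuedIn ι₁ Φ.1) id, τ = (ι₁ ∘ g) ∘ algebraMap`;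
* `mem_reflexCMType_id_iff_exists_mem_reflexLift_of_eq` + `comp_algebraMap_comp_equivOfEq_symm` — the same TRANSPORTED along
  `ε := (IntermediateField.equivOfEq _)⁻¹` to ANY index set `S` with `S = algValuedIn ι₁ Φ.1` (post-port: `S := autImage (autSet ι₁ Φ)`
  by the first bullet), i.e. clauses (ii) and (i) of `IsReflexOf` with the package bodies substituted;
* `mem_reflexCMType_invType_iff_exists` — orientation check against the displays' choice `hμ` (`Φ_μ = invType ι₁ Φ`, item (ii)):
  the complex reflex type of `Φ_μ = Φ^{*ι₁}` consists of the restrictions of the embeddings of `Φ` ITSELF (`invType` is an involution;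
  tree `comp_smul_val_mem_reflexCMType_id_iff`: the reflex type of `Θ` restricts `Θ^{*ι}`).
What remains of R2 after this file is LITERAL: `unfold IsReflexOfType IsReflexOf reflexTypeC reflexFieldOf autImage autSet` on the
ported module and `exact ⟨ε, comp_algebraMap_comp_equivOfEq_symm …, mem_reflexCMType_id_iff_exists_mem_reflexLift_of_eq …⟩` — plus
R2a (the index-line type `typeOfLine (line i)` ↔ `Φ_μ`, X3 row «Char ↔ I», own-htheta / pin-3).  Nothing here touches a binder or a count.

References: G. Shimura, *Abelian Varieties with Complex Multiplication and Modular Functions* (1998) §8.3 Prop. 28; Y. Liu,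
*Fourier–Jacobi cycles and arithmetic relative trace formula*, Camb. J. Math. 9 (2021) = arXiv:2102.11518, Def. 4.3 (2)
(`FJcycle.tex` l. 1914–1921: «`M'_μ ⊆ ℂ` the reflex field of `(E, Φ_μ)`, with the induced CM type `Ψ_μ`»).
-/

set_option autoImplicit false

open scoped Pointwise

namespace Summit.HodgeConjecture.CorCM.Transposition

open NumberField
open Literature.AlgebraicGeometry.Motives (CMType)
open Literature.NumberTheory.ComplexMultiplication

/-! ## §1 The index set: the package body `↑ '' {g | ι₁ ∘ g ∈ Φ}` is the tree's `algValuedIn ι₁ Φ` -/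

section IndexSet

variable {L : Type*} [Field L] [NumberField L]

/-- **(F) index sets agree.**  The body of the package's `autImage (autSet ι₁ Φ)` — the image in `Hom_ℚ(L, L)` of
`{g ∈ Aut_ℚ(L) | ι₁ ∘ g ∈ Φ}` — EQUALS the tree's `algValuedIn ι₁ Φ.1 = {χ | ι₁ ∘ χ ∈ Φ}`: every `ℚ`-algebra endomorphism of a
number field is an automorphism.  (x2 g6 probe (F), filed here as a tree theorem.) [folklore] -/
theorem image_coe_setOf_comp_mem_eq_algValuedIn (ι₁ : L →+* ℂ) (Φ : CMType L) :
    (fun σ : L ≃ₐ[ℚ] L => (σ : L →ₐ[ℚ] L)) '' {g : L ≃ₐ[ℚ] L | ι₁.comp g.toRingEquiv.toRingHom ∈ Φ.1} =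
      algValuedIn ι₁ Φ.1 := by
  ext χ
  rw [mem_algValuedIn_iff, Set.mem_image]
  constructor
  · rintro ⟨g, hg, rfl⟩
    exact hg
  · intro hχ
    refine ⟨AlgEquiv.ofBijective χ (Algebra.IsAlgebraic.algHom_bijective χ), hχ, ?_⟩
    ext x
    rfl

/-- Hence the two reflex fields are the same intermediate field of `L`. [folklore] -/
theorem reflexField_image_coe_setOf_comp_mem_eq (ι₁ : L →+* ℂ) (Φ : CMType L) :
    reflexField ℚ L ((fun σ : L ≃ₐ[ℚ] L => (σ : L →ₐ[ℚ] L)) ''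
        {g : L ≃ₐ[ℚ] L | ι₁.comp g.toRingEquiv.toRingHom ∈ Φ.1}) =
      reflexField ℚ L (algValuedIn ι₁ Φ.1) := by
  rw [image_coe_setOf_comp_mem_eq_algValuedIn]

end IndexSet

/-! ## §2 The reflex type: the tree's `reflexCMType ι₁ Φ id` is the package body of `reflexTypeC` -/

section ReflexType

variable {L : Type*} [Field L] [NumberField L]

/-- `ι₁ ∘ (g|_{K*})` written with `algebraMap`: `ι₁.comp ↑(g • K*.val) = (ι₁.comp ↑g).comp (algebraMap K* L)`. [folklore] -/
theorem comp_coe_smul_val_eq_comp_comp_algebraMap (ι₁ : L →+* ℂ) (K : IntermediateField ℚ L) (g : L ≃ₐ[ℚ] L) :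
    ι₁.comp ((g • K.val : K →ₐ[ℚ] L) : K →+* L) = (ι₁.comp (g : L →+* L)).comp (algebraMap K L) :=
  RingHom.ext fun _ => rfl

/-- The same, evaluated. [folklore] -/
theorem comp_coe_smul_val_apply (ι₁ : L →+* ℂ) (K : IntermediateField ℚ L) (g : L ≃ₐ[ℚ] L) (x : K) :
    ι₁.comp ((g • K.val : K →ₐ[ℚ] L) : K →+* L) x = ι₁ (g x) :=
  rfl

/-- **(T) the tree reflex type IS the package body** (at the tree index set): for `L/ℚ` Galois CM, `ι₁ : L → ℂ`, `Φ` a CM type of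
`L` and `K* = reflexField ℚ L (algValuedIn ι₁ Φ)`,
`τ ∈ (reflexCMType ι₁ Φ id).1 ↔ ∃ g ∈ reflexLift (algValuedIn ι₁ Φ) id, τ = (ι₁ ∘ g) ∘ algebraMap K* L`
— the right-hand side is the definiens of the package's `reflexTypeC ι₁ T` (JLiuCornerOfReflex.lean :79–:82) with `autImage T`
replaced by the tree index set. [cite: Shimura1998, §8.3 Prop. 28] -/
theorem mem_reflexCMType_id_iff_exists_mem_reflexLift [IsCMField L] [IsGalois ℚ L] (ι₁ : L →+* ℂ) (Φ : CMType L)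
    (τ : reflexField ℚ L (algValuedIn ι₁ Φ.1) →+* ℂ) :
    τ ∈ (reflexCMType ι₁ Φ (AlgHom.id ℚ L)).1 ↔
      ∃ g ∈ (reflexLift (algValuedIn ι₁ Φ.1) (AlgHom.id ℚ L) : Set (L ≃ₐ[ℚ] L)),
        τ = (ι₁.comp (g : L →+* L)).comp (algebraMap (reflexField ℚ L (algValuedIn ι₁ Φ.1)) L) := by
  rw [mem_reflexCMType_iff]
  constructor
  · rintro ⟨ψ, hψ, rfl⟩
    obtain ⟨g, hg, rfl⟩ := (mem_reflexType_iff ℚ L _ _ ψ).mp hψ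
    exact ⟨g, hg, comp_coe_smul_val_eq_comp_comp_algebraMap ι₁ _ g⟩
  · rintro ⟨g, hg, rfl⟩
    exact ⟨g • (reflexField ℚ L (algValuedIn ι₁ Φ.1)).val, smul_val_mem_reflexType ℚ L hg,
      comp_coe_smul_val_eq_comp_comp_algebraMap ι₁ _ g⟩

/-- **(T′) transport to any presentation of the index set** — clause (ii) of the package's `IsReflexOf` with its bodies substituted:
for `S = algValuedIn ι₁ Φ` (post-port: `S := autImage (autSet ι₁ Φ)`, §1) and
`ε := equivOfEq (congrArg (reflexField ℚ L) hS) : ↥(reflexField ℚ L S) ≃ₐ[ℚ] K*`,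
`τ ∈ (reflexCMType ι₁ Φ id).1 ↔ ∃ g ∈ reflexLift S id, τ ∘ ε = (ι₁ ∘ g) ∘ algebraMap ↥(reflexField ℚ L S) L`.
[cite: Shimura1998, §8.3 Prop. 28] -/
theorem mem_reflexCMType_id_iff_exists_mem_reflexLift_of_eq [IsCMField L] [IsGalois ℚ L] (ι₁ : L →+* ℂ) (Φ : CMType L)
    {S : Set (L →ₐ[ℚ] L)} (hS : S = algValuedIn ι₁ Φ.1)
    (τ : reflexField ℚ L (algValuedIn ι₁ Φ.1) →+* ℂ) :
    τ ∈ (reflexCMType ι₁ Φ (AlgHom.id ℚ L)).1 ↔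
      ∃ g ∈ (reflexLift S (AlgHom.id ℚ L) : Set (L ≃ₐ[ℚ] L)),
        τ.comp (IntermediateField.equivOfEq (congrArg (reflexField ℚ L) hS) :
            reflexField ℚ L S →+* reflexField ℚ L (algValuedIn ι₁ Φ.1)) =
          (ι₁.comp (g : L →+* L)).comp (algebraMap (reflexField ℚ L S) L) := by
  subst hS
  rw [mem_reflexCMType_id_iff_exists_mem_reflexLift]
  refine exists_congr fun g => and_congr_right fun _ => ?_
  constructor
  · intro h
    rw [h]
    exact RingHom.ext fun _ => rfl
  · intro h
    refine RingHom.ext fun x => ?_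
    have := RingHom.congr_fun h x
    exact this

/-- **Clause (i) of `IsReflexOf` with its bodies substituted**: `ι₁ ∘ incl_S ∘ ε⁻¹ = ι₁ ∘ incl_{K*}` for the transport
`ε⁻¹ = (equivOfEq _).symm : K* ≃ ↥(reflexField ℚ L S)` (both sides send `x ∈ K* ⊆ L` to `ι₁ x`).  With the tree CM side's
`τ ∘ k = ι₁ ∘ incl_{K*}` (Liu's `e_μ`, `Item6PinMatch.lean` §0: `(e k : ℂ) = ι₁ k`) this is the package's first conjunct. [folklore] -/
theorem comp_algebraMap_comp_equivOfEq_symm (ι₁ : L →+* ℂ) (Φ : CMType L)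
    {S : Set (L →ₐ[ℚ] L)} (hS : S = algValuedIn ι₁ Φ.1) :
    (ι₁.comp (algebraMap (reflexField ℚ L S) L)).comp
        ((IntermediateField.equivOfEq (congrArg (reflexField ℚ L) hS)).symm :
          reflexField ℚ L (algValuedIn ι₁ Φ.1) →+* reflexField ℚ L S) =
      ι₁.comp (algebraMap (reflexField ℚ L (algValuedIn ι₁ Φ.1)) L) := by
  subst hS
  exact RingHom.ext fun _ => rfl

/-- (T) in evaluated form (packaging-free common criterion, x2 g6 (T)): `τ ∈ Φ*_ℂ ↔ ∃ g, ι₁ ∘ g⁻¹ ∈ Φ ∧ ∀ x ∈ K*, τ x = ι₁ (g x)`.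
[cite: Shimura1998, §8.3 Prop. 28] -/
theorem mem_reflexCMType_id_iff_exists_apply [IsCMField L] [IsGalois ℚ L] (ι₁ : L →+* ℂ) (Φ : CMType L)
    (τ : reflexField ℚ L (algValuedIn ι₁ Φ.1) →+* ℂ) :
    τ ∈ (reflexCMType ι₁ Φ (AlgHom.id ℚ L)).1 ↔
      ∃ g : L ≃ₐ[ℚ] L, ι₁.comp (g.symm : L →+* L) ∈ Φ.1 ∧
        ∀ x : reflexField ℚ L (algValuedIn ι₁ Φ.1), τ x = ι₁ (g x) := by
  rw [mem_reflexCMType_id_iff_exists]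
  refine exists_congr fun g => and_congr_right fun _ => ?_
  constructor
  · intro h x
    rw [h]
    rfl
  · intro h
    exact RingHom.ext fun x => h x

end ReflexType

/-! ## §3 Orientation check against the displays' choice `hμ : Φ_μ = invType ι₁ Φ` -/

section Orientation

variable {F : CMField} [IsGalois ℚ F]

/-- **The reflex type of the chosen `Φ_μ = Φ^{*ι₁}` restricts `Φ` itself.**  For the face type `Φ` and the character type
`Φ_μ := invType ι₁ Φ` of the END displays' binder `hμ` (item (ii), `Item2Holds.lean`; `Item6SupplyPinnedCertificate.lean` exhibits such `μ`),
the complex reflex type `Ψ_μ = reflexCMType ι₁ Φ_μ id` ([Liu2021] Def. 4.3 (2)) consists of the restrictions to `K* = M'_μ` of the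
embeddings `ι₁ ∘ g ∈ Φ` — because the reflex type of `Θ` restricts `Θ^{*ι₁}` (tree `mem_reflexCMType_id_iff_exists`) and
`(Φ^{*ι₁})^{*ι₁} = Φ` (`invType_invType`).  So the CM type `Ψ̃_μ` realised on `A_μ ⊗ ℂ` by R1 is INDUCED FROM THE FACE TYPE `Φ`.
[cite: Shimura1998, §8.3 Prop. 28] -/
theorem mem_reflexCMType_invType_iff_exists (ι₁ : F →+* ℂ) (Φ : CMType F)
    (τ : reflexField ℚ F (algValuedIn ι₁ (invType ι₁ Φ).1) →+* ℂ) :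
    τ ∈ (reflexCMType ι₁ (invType ι₁ Φ) (AlgHom.id ℚ F)).1 ↔
      ∃ g : F ≃ₐ[ℚ] F, ι₁.comp (g : F →+* F) ∈ Φ.1 ∧
        ∀ x : reflexField ℚ F (algValuedIn ι₁ (invType ι₁ Φ).1), τ x = ι₁ (g x) := by
  rw [mem_reflexCMType_id_iff_exists_apply]
  refine exists_congr fun g => and_congr_left fun _ => ?_
  rw [← comp_mem_invType_iff, invType_invType]

/-- The same read on `Gal(F/ℚ)`: `ι₁ ∘ g|_{K*} ∈ Ψ_μ ↔ ι₁ ∘ g ∈ Φ` (for `Φ_μ = Φ^{*ι₁}`). [cite: Shimura1998, §8.3 Prop. 28] -/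
theorem comp_smul_val_mem_reflexCMType_invType_iff (ι₁ : F →+* ℂ) (Φ : CMType F) (g : F ≃ₐ[ℚ] F) :
    ι₁.comp ((g • (reflexField ℚ F (algValuedIn ι₁ (invType ι₁ Φ).1)).val :
        reflexField ℚ F (algValuedIn ι₁ (invType ι₁ Φ).1) →ₐ[ℚ] F) :
          reflexField ℚ F (algValuedIn ι₁ (invType ι₁ Φ).1) →+* F) ∈
        (reflexCMType ι₁ (invType ι₁ Φ) (AlgHom.id ℚ F)).1 ↔
      ι₁.comp (g : F →+* F) ∈ Φ.1 := by
  rw [comp_smul_val_mem_reflexCMType_id_iff, ← comp_mem_invType_iff, invType_invType]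

end Orientation

end Summit.HodgeConjecture.CorCM.Transposition
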